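import Summits.NavierStokesRegularity.TurbBounds.ShearDensity
import Summits.NavierStokesRegularity.TurbBounds.LegendreCoeffs
import Summits.NavierStokesRegularity.TurbBounds.Certs.S1000.CutoffFree
import HarnessLib

/-!
# Row R1 = C1′ (FW16 2-D stress-driven shear layer, Γx = 2, Gr = 10³) from TWO named hypotheses: the cited reduction `FW16Reduction`
# and the per-mode polynomial positivity `PolyPositivityS1000` of the certified modes — cutoff, cover, relaxation, density, profileS1000
# arithmetic kernel-checked
(cell `pub-turb` / `turb-bounds`, shear lane; v2 staging, written by pub-turb-shear gen 7, 2026-08-22. CERTIFIED.md row R1 (= C1′, the P-converged twin of the cell's first certificate C1), `C_ε ≤ 0.00747522017` at `Gr = 1000`, `Γx = 2`;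
scalar lines in the tree as `Certs.S1000.Scalars` (p-ids in LEAN-MAP §0), blocks `Certs.S1000.B001…B014`, evaluator `Certs.S1000.EvalBlock1…14`, `CutoffFree`, `TailSlack`.)

HONEST FRAMING: rigorous bounds for the stated PDE and boundary conditions; no claim about physical turbulence beyond the bound.
WHAT IS KERNEL-CHECKED HERE: with `φ′ := Σ_{p ≤ 20} φ̂_p P_p` the row's literal profile derivative (`profileS1000`; `φ̂ = Certs.S1000.Scalars.phi`):
`profileS1000_eval_one` (`φ′(1) = Gr/2`, the stress boundary condition, from `Scalars.sum_phi`), `profileS1000_abs_le` (`|φ′| ≤ ‖φ̂‖₁ = T` on `[−1, 1]`,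
from `|P_p| ≤ 1`), `boundValue_profileS1000` (`2∫φ′ − (2/Gr)∫φ′² = U(φ̂) = Scalars.U` by finite Parseval), and
`fw16Positivity_of_polyPositivity`: IF the relaxed forms of the fourteen certified modes are `≥ 0` on admissible POLYNOMIAL pairs (`PolyPositivityS1000`)
THEN FW16's spectral constraint holds for EVERY mode `m ≥ 1` on the admissible `C²` class (`ShearDensity.shearForm_nonneg_of_poly` →
`ShearForm.fw16Form_nonneg_of_shearForm_cell` → `ShearForm.fw16Positivity_of_cover` with the landed cutoff line `Certs.S1000.Scalars.cutoff`).
CONSEQUENCES: `surfaceVelocity_bound` — for every `ū` obeying `FW16Reduction 2 1000 ū` (the cited reduction; docstring in `ShearForm`):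
`PolyPositivityS1000 → 365.753091564 ≤ U ≤ ū`, and `ceps_bound` : `C_ε = Gr/ū² ≤ Scalars.Ceps ≤ 0.00747522017`.
THE SECOND HYPOTHESIS `PolyPositivityS1000` is exactly what the staged algebraic chain discharges (`Certs.S1000.ModeForm.M1…M14.modeForm_nonneg` +
`ShearBridgeNorms.norms_split` + the cross-term split on cert's Legendre triple products, v2 items V2-BRIDGE / V2-TAIL); it is stated here
as a `Prop` so that this file lands independently of them (84 Cb chunk files), exactly as `Results/P2R0.lean` first took `TailLemma` as a hypothesis.
NOT CLAIMED: any formalisation of the Navier–Stokes reduction (`FW16Reduction` stays a hypothesis, as in the paper's §4 / A.8).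
-/

set_option linter.style.longLine false

noncomputable section

namespace Summit.NavierStokesRegularity.TurbBounds.Results.S1000

open Polynomial intervalIntegral MeasureTheory Set Finset
open Literature.Analysis.SpecialFunctions (legendre eval_one_legendre natDegree_legendre abs_eval_legendre_le_one legendre_zero)
open Summit.NavierStokesRegularity.TurbBounds.ShearForm
open Summit.NavierStokesRegularity.TurbBounds.ShearDensity (shearForm_nonneg_of_poly)
open Summit.NavierStokesRegularity.TurbBounds.LegendreCoeffs
open Summit.NavierStokesRegularity.TurbBounds.LadderTail (w)
open Summit.NavierStokesRegularity.TurbBounds.Certs.S1000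

/-! ## 1. The row's profile derivative and its three scalar facts -/

/-- The row's Legendre data `φ̂_p` as real numbers (`Certs.S1000.Scalars.phi`, `P = 20`; `0` beyond). -/
def phiS1000 (p : ℕ) : ℝ := ((Scalars.phi.getD p 0 : ℚ) : ℝ)

/-- The profile derivative `φ′ = dφ/dζ = Σ_{p ≤ 20} φ̂_p P_p(ζ)` of the certified background field (FW16 (4.4)). -/
def profileS1000 : ℝ[X] := ∑ p ∈ range (20 + 1), C (phiS1000 p) * legendre p

/-- Legendre coefficients of the profile derivative: `ĉ_n(φ′) = φ̂_n` (`n ≤ 20`), `0` beyond. -/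
theorem legCoeff_profileS1000 (n : ℕ) : legCoeff profileS1000 n = if n ≤ 20 then phiS1000 n else 0 :=
  legCoeff_expansion 20 phiS1000 n

/-- `deg φ′ ≤ 20`. -/
theorem natDegree_profileS1000_le : profileS1000.natDegree ≤ 20 := by
  unfold profileS1000
  refine natDegree_sum_le_of_forall_le _ _ fun p hp => ?_
  have hp4 : p ≤ 20 := by simp at hp; omega
  exact (natDegree_C_mul_le _ _).trans ((natDegree_legendre p).le.trans hp4)

/-- **Stress boundary condition** `φ′(1) = Σ φ̂_p = Gr/2` (FW16 (4.5); `Scalars.sum_phi`). -/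
theorem profileS1000_eval_one : profileS1000.eval 1 = (Scalars.Gr : ℝ) / 2 := by
  unfold profileS1000
  rw [eval_finsetSum]
  simp only [eval_mul, eval_C, eval_one_legendre, mul_one, Finset.sum_range_succ, Finset.sum_range_zero, phiS1000]
  norm_num [Scalars.phi, Scalars.Gr]

/-- **Sup bound** `|φ′(x)| ≤ ‖φ̂‖₁ = T` on `[−1, 1]` (FW16 (4.6); `|P_p| ≤ 1`, `Scalars.l1_phi`). -/
theorem profileS1000_abs_le : ∀ x ∈ Icc (-1 : ℝ) 1, |profileS1000.eval x| ≤ (Scalars.T : ℝ) := by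
  intro x hx
  have hx1 : |x| ≤ 1 := abs_le.mpr ⟨hx.1, hx.2⟩
  unfold profileS1000
  rw [eval_finsetSum]
  calc |∑ p ∈ range (20 + 1), (C (phiS1000 p) * legendre p).eval x|
      ≤ ∑ p ∈ range (20 + 1), |(C (phiS1000 p) * legendre p).eval x| := Finset.abs_sum_le_sum_abs _ _
    _ ≤ ∑ p ∈ range (20 + 1), |phiS1000 p| := by
        refine Finset.sum_le_sum fun p _ => ?_
        rw [eval_mul, eval_C, abs_mul]
        calc |phiS1000 p| * |(legendre p).eval x| ≤ |phiS1000 p| * 1 :=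
              mul_le_mul_of_nonneg_left (abs_eval_legendre_le_one p hx1) (abs_nonneg _)
          _ = |phiS1000 p| := mul_one _
    _ = (Scalars.T : ℝ) := by
        simp only [Finset.sum_range_succ, Finset.sum_range_zero, phiS1000]
        norm_num [Scalars.phi, Scalars.T]

/-- `∫_{−1}^{1} φ′ = 2φ̂₀` (= `φ(1)`, FW16 App. A). -/
theorem integral_profileS1000 : (∫ x in (-1 : ℝ)..1, profileS1000.eval x) = 2 * phiS1000 0 := by
  have h := legCoeff_profileS1000 0
  rw [if_pos (by norm_num)] at h
  unfold legCoeff at h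
  have e : (∫ x in (-1 : ℝ)..1, profileS1000.eval x * (legendre 0).eval x) = ∫ x in (-1 : ℝ)..1, profileS1000.eval x :=
    intervalIntegral.integral_congr fun x _ => by simp [legendre_zero]
  rw [e] at h
  norm_num at h
  linarith

/-- `∫_{−1}^{1} φ′² = Σ_{p ≤ 20} (2/(2p+1)) φ̂_p²` (finite Parseval, FW16 (4.7)). -/
theorem integral_profileS1000_sq : (∫ x in (-1 : ℝ)..1, profileS1000.eval x ^ 2) = ∑ k ∈ range (20 + 1), w k * phiS1000 k ^ 2 := by
  rw [integral_sq_eq_sum profileS1000 natDegree_profileS1000_le]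
  refine Finset.sum_congr rfl fun k hk => ?_
  rw [legCoeff_profileS1000, if_pos (by simp at hk; omega)]

/-- **The bound value is the certified `U`**: `2∫φ′ − (2/Gr)∫φ′² = 4φ̂₀ − (2/Gr)Σ 2φ̂_p²/(2p+1) = Scalars.U` (FW16 (4.10); `Scalars.U_eq`). -/
theorem boundValue_profileS1000 : boundValue (Scalars.Gr : ℝ) (fun x => profileS1000.eval x) = (Scalars.U : ℝ) := by
  unfold boundValue
  rw [integral_profileS1000, integral_profileS1000_sq]
  simp only [Finset.sum_range_succ, Finset.sum_range_zero, phiS1000, w]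
  norm_num [Scalars.phi, Scalars.Gr, Scalars.U]

/-! ## 2. The second named hypothesis: polynomial positivity of the certified modes -/

/-- **Named hypothesis `PolyPositivityS1000`** (to be DISCHARGED by the staged algebraic chain; v2 items V2-BRIDGE/V2-TAIL): for each certified mode
`m = 1, …, m_cert = 14` of the row and every pair of real polynomials `(U, V)` with `U(±1) = V(±1) = 0`, `U′(−1) = V′(−1) = 0`, the relaxed
per-mode form of rbsdp SPEC 2.2 with the cell's constants `A_m, C_m, D_m` (`ShearForm.Acell/Ccell/Dcell` at `Γx = Scalars.Gx`) and the row's profile derivative `φ′` is `≥ 0`: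
`A_m‖W″‖² + 8‖W′‖² + C_m‖W‖² − D_m ∫φ′·Im(W′W̄) ≥ 0`, `W = U + iV`. (On polynomial pairs this number IS, by `ShearBridgeNorms.norms_split` and
the cross-term identity, the right-hand side of `Certs.S1000.ModeForm.M<m>.modeForm_nonneg` at the Legendre coefficients of `W″`.) -/
def PolyPositivityS1000 : Prop :=
  ∀ m : ℕ, 1 ≤ m → m ≤ Scalars.mCert → ∀ Up Vp : ℝ[X],
    Up.eval (-1) = 0 → (derivative Up).eval (-1) = 0 → Up.eval 1 = 0 →
    Vp.eval (-1) = 0 → (derivative Vp).eval (-1) = 0 → Vp.eval 1 = 0 →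
    0 ≤ shearForm (Acell (Scalars.Gx : ℝ) m) (Ccell (Scalars.Gx : ℝ) m) (Dcell (Scalars.Gx : ℝ) m)
      (fun x => profileS1000.eval x) (fun x => Up.eval x) (fun x => Vp.eval x)

/-- **From polynomial positivity of the fourteen certified modes to FW16's spectral constraint for EVERY mode** on the admissible `C²` class:
density (`ShearDensity`), the rational relaxation with the cell's constants (`fw16Form_nonneg_of_shearForm_cell`), and the cover by the landed
cutoff line `Certs.S1000.Scalars.cutoff` (modes `m ≥ 15` are free, FW16 (2.17)–(2.18)). -/
theorem fw16Positivity_of_polyPositivity (h : PolyPositivityS1000) : FW16Positivity (Scalars.Gx : ℝ) (fun x => profileS1000.eval x) := by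
  have hGx : (0 : ℝ) < (Scalars.Gx : ℝ) := by norm_num [Scalars.Gx]
  refine fw16Positivity_of_cover hGx profileS1000_abs_le Scalars.cutoff fun m hm hle U V hUV => ?_
  have hpoly := shearForm_nonneg_of_poly (A := Acell (Scalars.Gx : ℝ) m) (C := Ccell (Scalars.Gx : ℝ) m) (D := Dcell (Scalars.Gx : ℝ) m)
    profileS1000.continuous (fun Up Vp h0 h1 h2 h3 h4 h5 => h m hm hle Up Vp h0 h1 h2 h3 h4 h5) hUV
  exact fw16Form_nonneg_of_shearForm_mode hGx hm profileS1000.continuous hUV.hU hUV.hV hpoly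

/-! ## 3. The row theorem from the two named hypotheses -/

/-- **Row R1, mean surface velocity.** For every `ū` obeying the cited reduction `FW16Reduction Γx Gr ū` at `(Γx, Gr) = (2, 1000)` and given
`PolyPositivityS1000`: `U = Scalars.U ≤ ū` (`U ≥ 365.753091564`, `Scalars.U_decimal`). -/
theorem surfaceVelocity_bound (ubar : ℝ) (hRed : FW16Reduction (Scalars.Gx : ℝ) (Scalars.Gr : ℝ) ubar) (hPoly : PolyPositivityS1000) :
    (Scalars.U : ℝ) ≤ ubar := by
  rw [← boundValue_profileS1000]
  exact hRed profileS1000 profileS1000_eval_one (fw16Positivity_of_polyPositivity hPoly)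

/-- **Row R1, dissipation coefficient.** Under the same two hypotheses `C_ε = Gr/ū² ≤ Scalars.Ceps` (`= Gr/U²`, `Scalars.Ceps_eq`). -/
theorem ceps_bound (ubar : ℝ) (hRed : FW16Reduction (Scalars.Gx : ℝ) (Scalars.Gr : ℝ) ubar) (hPoly : PolyPositivityS1000) :
    (Scalars.Gr : ℝ) / ubar ^ 2 ≤ (Scalars.Ceps : ℝ) := by
  have hU : (0 : ℝ) < (Scalars.U : ℝ) := by exact_mod_cast Scalars.U_pos
  have hGr : (0 : ℝ) ≤ (Scalars.Gr : ℝ) := by norm_num [Scalars.Gr]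
  have hC : (Scalars.Ceps : ℝ) = (Scalars.Gr : ℝ) / (Scalars.U : ℝ) ^ 2 := by
    have h := Scalars.Ceps_eq
    rw [h]; push_cast; ring
  rw [hC]
  exact ceps_le_of_lower_bound hGr hU (surfaceVelocity_bound ubar hRed hPoly)

/-- The outward decimal of CERTIFIED.md row R1: `C_ε ≤ 0.00747522017`. -/
theorem ceps_bound_decimal (ubar : ℝ) (hRed : FW16Reduction (Scalars.Gx : ℝ) (Scalars.Gr : ℝ) ubar) (hPoly : PolyPositivityS1000) :
    (Scalars.Gr : ℝ) / ubar ^ 2 ≤ (747522017 : ℝ) / 100000000000 := by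
  have h := ceps_bound ubar hRed hPoly
  have hd : ((Scalars.Ceps : ℚ) : ℝ) ≤ (((747522017 : ℚ) / 100000000000 : ℚ) : ℝ) := by exact_mod_cast Scalars.Ceps_decimal
  push_cast at hd
  linarith

/-! ## 4. Vacuity guards -/

/-- The first hypothesis is satisfiable as typed at this row's parameters (laminar value `ū = Gr = 1000`). -/
theorem fw16Reduction_laminar_row : FW16Reduction (2 : ℝ) 1000 1000 :=
  fw16Reduction_laminar 2 (by norm_num)

/-- … and, given `PolyPositivityS1000`, NOT provable for every `ū`: `ū = 0` violates it (`U > 0`). -/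
theorem fw16Reduction_nontrivial (hPoly : PolyPositivityS1000) : ¬ FW16Reduction (Scalars.Gx : ℝ) (Scalars.Gr : ℝ) 0 := by
  intro hRed
  have h := surfaceVelocity_bound 0 hRed hPoly
  have hU : (0 : ℝ) < (Scalars.U : ℝ) := by exact_mod_cast Scalars.U_pos
  linarith

end Summit.NavierStokesRegularity.TurbBounds.Results.S1000

end
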